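import Mathlib
import Summits.MatrixMultiplication.MatrixMultiplication.Theses.SuccinctSecantEquations

/-!
# Birth skeleton (BC3) of piece `SuccinctSeparationProductLaw` of the split of `SuccinctSeparation` (stmt-MatrixMultiplication-7986)

Two named stubs and the kernel-checked composition `SuccinctSeparationProductLaw_of`; identical to the corresponding section of the
registered line `Cruxes/SuccinctSeparation/Lines/seed-tensorise.lean` (namespace `…SeedTensorise`), extracted so the
piece carries its own certificate.  `lean check`: rc 0, sorries = 2 (the stubs), none elsewhere.
-/

set_option linter.dupNamespace false

noncomputable section

namespace Summit.MatrixMultiplication.MatrixMultiplication.Cruxes.SuccinctSeparation.BirthProductLaw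

/-! ## Statements -/

/-- Piece 2 of the split, verbatim: SUCCINCT SEPARATION PRODUCT LAW. -/
def SuccinctSeparationProductLaw : Prop := ∀ a : ℕ, ∃ k : ℕ, 0 < k ∧ ∃ A : ℕ, ∀ (n m r r' : ℕ) (F : MvPolynomial ((Fin n × Fin n) × (Fin n × Fin n) × (Fin n × Fin n)) ℂ) (F' : MvPolynomial ((Fin m × Fin m) × (Fin m × Fin m) × (Fin m × Fin m)) ℂ), 2 ≤ n → 2 ≤ m → n ^ 2 ≤ r → m ^ 2 ≤ r' → Literature.Computability.AlgebraicComplexity.complexity F ≤ n ^ a → Literature.Computability.AlgebraicComplexity.complexity F' ≤ m ^ a → (∀ T : Fin n × Fin n → Fin n × Fin n → Fin n × Fin n → ℂ, Literature.Computability.AlgebraicComplexity.tensorRank T ≤ r → MvPolynomial.eval (fun p => T p.1 p.2.1 p.2.2) F = 0) → MvPolynomial.eval (fun p => Literature.Computability.AlgebraicComplexity.matMulTensor ℂ n n n p.1 p.2.1 p.2.2) F ≠ 0 → (∀ T : Fin m × Fin m → Fin m × Fin m → Fin m × Fin m → ℂ, Literature.Computability.AlgebraicComplexity.tensorRank T ≤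 r' → MvPolynomial.eval (fun p => T p.1 p.2.1 p.2.2) F' = 0) → MvPolynomial.eval (fun p => Literature.Computability.AlgebraicComplexity.matMulTensor ℂ m m m p.1 p.2.1 p.2.2) F' ≠ 0 → ∃ G : MvPolynomial ((Fin (n * m) × Fin (n * m)) × (Fin (n * m) × Fin (n * m)) × (Fin (n * m) × Fin (n * m))) ℂ, Literature.Computability.AlgebraicComplexity.complexity G ≤ max (A * Literature.Computability.AlgebraicComplexity.complexity F * Literature.Computability.AlgebraicComplexity.complexity F') ((n * m) ^ a) ∧ (∀ T : Fin (n * m) × Fin (n * m) → Fin (n * m) × Fin (n * m) → Fin (n * m) × Fin (n * m) → ℂ, Literature.Computability.AlgebraicComplexity.tensorRank T ≤ r * r' / k → MvPolynomial.eval (fun p => T p.1 p.2.1 p.2.2) G = 0) ∧ MvPolynomial.eval (fun p => Literature.Computability.AlgebraicComplexity.matMulTensor ℂ (n * m) (n * m) (n * m) p.1 p.2.1 p.2.2) G ≠ 0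

/-- Stub 3 statement: the LEVEL LAW (size-free conclusion) — levels carried by succinct separations of `⟨n⟩` and `⟨m⟩`
multiply up to a constant `k_a`: SOME polynomial separates `σ_{⌊r r'/k⌋}` from `⟨nm, nm, nm⟩`. -/
def LevelLaw : Prop :=
  ∀ a : ℕ, ∃ k : ℕ, 0 < k ∧ ∀ (n m r r' : ℕ)
    (F : MvPolynomial ((Fin n × Fin n) × (Fin n × Fin n) × (Fin n × Fin n)) ℂ)
    (F' : MvPolynomial ((Fin m × Fin m) × (Fin m × Fin m) × (Fin m × Fin m)) ℂ),
    2 ≤ n → 2 ≤ m → n ^ 2 ≤ r → m ^ 2 ≤ r' →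
    Literature.Computability.AlgebraicComplexity.complexity F ≤ n ^ a →
    Literature.Computability.AlgebraicComplexity.complexity F' ≤ m ^ a →
    (∀ T : Fin n × Fin n → Fin n × Fin n → Fin n × Fin n → ℂ,
      Literature.Computability.AlgebraicComplexity.tensorRank T ≤ r →
        MvPolynomial.eval (fun p => T p.1 p.2.1 p.2.2) F = 0) →
    MvPolynomial.eval (fun p =>
      Literature.Computability.AlgebraicComplexity.matMulTensor ℂ n n n p.1 p.2.1 p.2.2) F ≠ 0 →
    (∀ T : Fin m × Fin m → Fin m × Fin m → Fin m × Fin m → ℂ,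
      Literature.Computability.AlgebraicComplexity.tensorRank T ≤ r' →
        MvPolynomial.eval (fun p => T p.1 p.2.1 p.2.2) F' = 0) →
    MvPolynomial.eval (fun p =>
      Literature.Computability.AlgebraicComplexity.matMulTensor ℂ m m m p.1 p.2.1 p.2.2) F' ≠ 0 →
    ∃ G₀ : MvPolynomial ((Fin (n * m) × Fin (n * m)) × (Fin (n * m) × Fin (n * m)) ×
        (Fin (n * m) × Fin (n * m))) ℂ,
      (∀ T : Fin (n * m) × Fin (n * m) → Fin (n * m) × Fin (n * m) → Fin (n * m) × Fin (n * m) → ℂ,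
        Literature.Computability.AlgebraicComplexity.tensorRank T ≤ r * r' / k →
          MvPolynomial.eval (fun p => T p.1 p.2.1 p.2.2) G₀ = 0) ∧
      MvPolynomial.eval (fun p =>
        Literature.Computability.AlgebraicComplexity.matMulTensor ℂ (n * m) (n * m) (n * m)
          p.1 p.2.1 p.2.2) G₀ ≠ 0

/-- Stub 4 statement: the SUCCINCT LIFT (the size clause) — below the product level `L ≤ r r'`, separability in
principle of `σ_L` from `⟨nm⟩` plus succinct certificates for the factors give a succinct separation at level
`⌊L/k⌋` within the product-law budget `max(A·s·s', (nm)^a)`. -/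
def SuccinctLift : Prop :=
  ∀ a : ℕ, ∃ k : ℕ, 0 < k ∧ ∃ A : ℕ, ∀ (n m r r' L : ℕ)
    (F : MvPolynomial ((Fin n × Fin n) × (Fin n × Fin n) × (Fin n × Fin n)) ℂ)
    (F' : MvPolynomial ((Fin m × Fin m) × (Fin m × Fin m) × (Fin m × Fin m)) ℂ),
    2 ≤ n → 2 ≤ m → n ^ 2 ≤ r → m ^ 2 ≤ r' →
    Literature.Computability.AlgebraicComplexity.complexity F ≤ n ^ a →
    Literature.Computability.AlgebraicComplexity.complexity F' ≤ m ^ a →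
    (∀ T : Fin n × Fin n → Fin n × Fin n → Fin n × Fin n → ℂ,
      Literature.Computability.AlgebraicComplexity.tensorRank T ≤ r →
        MvPolynomial.eval (fun p => T p.1 p.2.1 p.2.2) F = 0) →
    MvPolynomial.eval (fun p =>
      Literature.Computability.AlgebraicComplexity.matMulTensor ℂ n n n p.1 p.2.1 p.2.2) F ≠ 0 →
    (∀ T : Fin m × Fin m → Fin m × Fin m → Fin m × Fin m → ℂ,
      Literature.Computability.AlgebraicComplexity.tensorRank T ≤ r' →
        MvPolynomial.eval (fun p => T p.1 p.2.1 p.2.2) F' = 0) →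
    MvPolynomial.eval (fun p =>
      Literature.Computability.AlgebraicComplexity.matMulTensor ℂ m m m p.1 p.2.1 p.2.2) F' ≠ 0 →
    L ≤ r * r' →
    (∃ G₀ : MvPolynomial ((Fin (n * m) × Fin (n * m)) × (Fin (n * m) × Fin (n * m)) ×
        (Fin (n * m) × Fin (n * m))) ℂ,
      (∀ T : Fin (n * m) × Fin (n * m) → Fin (n * m) × Fin (n * m) → Fin (n * m) × Fin (n * m) → ℂ,
        Literature.Computability.AlgebraicComplexity.tensorRank T ≤ L →
          MvPolynomial.eval (fun p => T p.1 p.2.1 p.2.2) G₀ = 0) ∧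
      MvPolynomial.eval (fun p =>
        Literature.Computability.AlgebraicComplexity.matMulTensor ℂ (n * m) (n * m) (n * m)
          p.1 p.2.1 p.2.2) G₀ ≠ 0) →
    ∃ G : MvPolynomial ((Fin (n * m) × Fin (n * m)) × (Fin (n * m) × Fin (n * m)) ×
        (Fin (n * m) × Fin (n * m))) ℂ,
      Literature.Computability.AlgebraicComplexity.complexity G ≤
          max (A * Literature.Computability.AlgebraicComplexity.complexity F *
            Literature.Computability.AlgebraicComplexity.complexity F') ((n * m) ^ a) ∧
      (∀ T : Fin (n * m) × Fin (n * m) → Fin (n * m) × Fin (n * m) → Fin (n * m) × Fin (n * m) → ℂ,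
        Literature.Computability.AlgebraicComplexity.tensorRank T ≤ L / k →
          MvPolynomial.eval (fun p => T p.1 p.2.1 p.2.2) G = 0) ∧
      MvPolynomial.eval (fun p =>
        Literature.Computability.AlgebraicComplexity.matMulTensor ℂ (n * m) (n * m) (n * m)
          p.1 p.2.1 p.2.2) G ≠ 0

/-! ## Stubs -/

/-- STUB 3 (open; geometry): the level law — succinctly certified levels multiply up to a constant at `⟨nm⟩`. -/
theorem stub_levelLaw : LevelLaw := by
  sorry

/-- STUB 4 (open; complexity): the succinct lift — below the product level, separability in principle plus succinct
factor certificates give a succinct separation with constant level loss. -/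
theorem stub_succinctLift : SuccinctLift := by
  sorry

/-! ## Composition (no sorry below) -/

/-- Stubs 3 + 4 give piece 2: with `k := k_a · k'_a`, the level law supplies a separation in principle at level
`⌊r r'/k_a⌋ ≤ r r'`, the succinct lift makes it succinct at level `⌊⌊r r'/k_a⌋/k'_a⌋ = ⌊r r'/(k_a k'_a)⌋`. [folklore] -/
theorem productLaw_of (h3 : LevelLaw) (h4 : SuccinctLift) : SuccinctSeparationProductLaw := by
  intro a
  obtain ⟨k, hk, hlev⟩ := h3 a
  obtain ⟨k', hk', A, hlift⟩ := h4 a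
  refine ⟨k * k', Nat.mul_pos hk hk', A, ?_⟩
  intro n m r r' F F' hn hm hr hr' hcF hcF' hvF hmF hvF' hmF'
  obtain ⟨G₀, hG₀v, hG₀m⟩ := hlev n m r r' F F' hn hm hr hr' hcF hcF' hvF hmF hvF' hmF'
  obtain ⟨G, hGc, hGv, hGm⟩ := hlift n m r r' (r * r' / k) F F' hn hm hr hr' hcF hcF' hvF hmF hvF'
    hmF' (Nat.div_le_self _ _) ⟨G₀, hG₀v, hG₀m⟩
  refine ⟨G, hGc, fun T hT => hGv T ?_, hGm⟩
  rwa [Nat.div_div_eq_div_mul]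

/-- BC3 composition under the canonical name `<C>_of`. [folklore] -/
theorem SuccinctSeparationProductLaw_of :
    LevelLaw → SuccinctLift → SuccinctSeparationProductLaw :=
  productLaw_of

/-- The piece from its registered stubs by name. [folklore] -/
theorem SuccinctSeparationProductLaw_holds_of_stubs : SuccinctSeparationProductLaw :=
  SuccinctSeparationProductLaw_of stub_levelLaw stub_succinctLift

end Summit.MatrixMultiplication.MatrixMultiplication.Cruxes.SuccinctSeparation.BirthProductLaw

end
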